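import Mathlib.Algebra.QuadraticDiscriminant
import Literature.Analysis.Calculus.BorderedImplicitFamily

/-!
# Second-order blow-up of the Lyapunov–Schmidt function along first-order-invisible directions
# and robust crossing from an indefinite quadratic form — the "invisible saddle"
# (Kielhöfer 2012, §I.4–I.6 and §I.16; Chow–Hale 1982, Ch. 6–7; Golubitsky–Schaeffer 1985, Ch. II)

Analysis/Calculus proof file (Mathlib only; theorems only, no definitions, no named facts).
Companion of `Literature.Analysis.Calculus.BorderedSecondOrder` (logically independent of it),
in the setting of `robustCrossing_of_fold` there: `N u = A u + B u u` is a continuous quadratic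
map with linearisation `T = A + B u₀ + B · u₀` at a zero `u₀` of `N + frc c`, `ψ` is a cokernel
functional (`ψ ∘ T = 0`, `ψ e = 1`), and `(σ, υ)` is a Lyapunov–Schmidt family on the ball of
radius `r` around `(c, 0) ∈ P × ℝ`: `N (υ q) + frc q.1 − σ q • e = 0`, `υ (c, 0) = u₀`, `υ` Fréchet
differentiable at `(c, 0)` with derivative `Dυ`.  By the exact reduced identity
(`reduced_identity` there, re-derived inline below: apply `ψ` to the difference of the equation
with the base equation, using the remainder-free expansion `N (u₀ + z) = N u₀ + T z + B z z`),
`σ q = ψ (B z z) + ψ (frc (q.1 − c))` with `z = υ q − u₀`.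

There the fold was treated: ONE parameter direction `d` is visible at first order,
`ψ (frc d) ≠ 0`.  Here we treat the complementary, degenerate situation in which the direction
`V = (d, x) ∈ P × ℝ` is INVISIBLE at first order, `ψ (frc d) = 0` (the kernel direction `(0, 1)`
always is).  Then the first-order term of `σ` along the ray `s ↦ (c, 0) + s V` vanishes
identically and the leading behaviour of `σ` is the quadratic form `V ↦ ψ (B (Dυ V) (Dυ V))`:

* `tendsto_sigma_div_sq` — SECOND-ORDER BLOW-UP: `s⁻² σ ((c, 0) + s V) → ψ (B (Dυ V) (Dυ V))`
  as `s → 0`, `s ≠ 0`.  Proof: `σ ((c, 0) + s V) = ψ (B z z)` exactly (the forcing term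
  `ψ (frc (s • d)) = s ψ (frc d)` vanishes), `s⁻¹ z → Dυ V` (difference quotients along the
  ray, chain rule), and `w ↦ ψ (B w w)` is continuous and `2`-homogeneous.
* `robustCrossing_of_indefinite` — ROBUST CROSSING FROM AN INDEFINITE SECOND-ORDER FORM (the
  "invisible saddle": the simplest instance of the degenerate-bifurcation analysis by the Newton
  polygon of the reduced function, Kielhöfer 2012 §I.16, Chow–Hale 1982 Ch. 7; compare the
  recognition of the simplest singularities `ε x² + δ λ²` in Golubitsky–Schaeffer 1985 Ch. II):
  if `d` is invisible and the binary quadratic form `x ↦ ψ (B (Dυ (d, x)) (Dυ (d, x)))` takes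
  both signs on the fibre `{d} × ℝ`, at `xp` and at `xm` say, then for every `η > 0` there are
  `s, x₁, x₂` with `dist (c + s d) c < η`, `|x₁|, |x₂| < η`, both points in the ball of the
  family, and `σ (c + s d, x₁) < 0 < σ (c + s d, x₂)`.  Proof: blow up along the two rays
  through `(d, xp)` and `(d, xm)`; for small `s ≠ 0` the signs of the two limits persist, and
  `(c, 0) + s (d, x) = (c + s d, s x)`.  No isolation, symmetry or nondegeneracy (`a ≠ 0`)
  hypothesis is needed.
* `robustCrossing_of_discriminant_pos` — the same with indefiniteness read off from the
  DISCRIMINANT: writing `Dυ (d, x) = w + x g₁`, `g₁ = Dυ (0, 1)`, `w = Dυ (d, 0)`, the form on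
  the fibre is the real binary quadratic `a x² + bm x + e₂` with `a = ψ (B g₁ g₁)`,
  `bm = ψ (B g₁ w) + ψ (B w g₁)`, `e₂ = ψ (B w w)`, which takes both signs as soon as
  `discrim a bm e₂ = bm² − 4 a e₂ > 0` (Mathlib's `discrim_le_zero`, `discrim_le_zero_of_nonpos`).

Not here: the DEFINITE form (the genuine isola centre, where `σ` need not cross), higher kernel
dimension, higher degeneracies (cusps, further sides of the Newton polygon), and the
Navier–Stokes instantiation (summit side).

## References

* H. Kielhöfer, *Bifurcation Theory. An Introduction with Applications to Partial Differential
  Equations*, 2nd ed., Applied Mathematical Sciences 156, Springer (2012), §I.4–I.6 (turning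
  points and bifurcation with a one-dimensional kernel via the reduced function), §I.16
  (degenerate bifurcation, the Newton polygon of the bifurcation function). [Kielhofer2012]
* S.-N. Chow, J. K. Hale, *Methods of Bifurcation Theory*, Grundlehren 251, Springer (1982),
  Ch. 6–7 (static bifurcation with one-dimensional kernel; quadratic and higher-order
  nonlinearities, the Newton polygon). [ChowHale1982]
* M. Golubitsky, D. G. Schaeffer, *Singularities and Groups in Bifurcation Theory*, Vol. I,
  Applied Mathematical Sciences 51, Springer (1985), Ch. II (the recognition problem for the
  simplest singularities). [GolubitskySchaeffer1985]
-/

noncomputable section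

open scoped Topology
open Filter Set Function

namespace Literature.Analysis.Calculus

section SecondOrderIndefinite

variable {X Y : Type*} [NormedAddCommGroup X] [NormedSpace ℝ X]
  [NormedAddCommGroup Y] [NormedSpace ℝ Y]
  {P : Type*} [NormedAddCommGroup P] [NormedSpace ℝ P]

/-! ## Second-order blow-up along a first-order-invisible direction -/

/-- **Second-order blow-up of the reduced function along a first-order-invisible direction**
(Kielhöfer 2012 §I.4–I.6, §I.16; Chow–Hale 1982 Ch. 6–7).  In the setting of
`robustCrossing_of_fold` (quadratic map `N u = A u + B u u`, linearisation `T` at the zero `u₀`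
of `N + frc c`, cokernel functional `ψ`, Lyapunov–Schmidt family `(σ, υ)` on the ball of radius
`r` around `(c, 0)`, `υ (c, 0) = u₀`, `υ` differentiable at `(c, 0)` with derivative `Dυ`), let
`V ∈ P × ℝ` be a direction whose parameter component is invisible at first order,
`ψ (frc V.1) = 0`.  Then `s⁻² · σ ((c, 0) + s V) → ψ (B (Dυ V) (Dυ V))` as `s → 0`, `s ≠ 0`: to
leading order the reduced function is quadratic along the ray, with coefficient the quadratic
form of `B` seen through `ψ` at the tangent vector `Dυ V`. [folklore] -/
theorem tendsto_sigma_div_sq (A : X →L[ℝ] Y) (B : X →L[ℝ] X →L[ℝ] Y) (T : X →L[ℝ] Y)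
    (frc : P →L[ℝ] Y) (u₀ : X) (c : P) (e : Y) (ψ : Y →L[ℝ] ℝ) (σ : P × ℝ → ℝ)
    (υ : P × ℝ → X) (Dυ : P × ℝ →L[ℝ] X) (r : ℝ) (hT : ∀ w, T w = A w + B u₀ w + B w u₀)
    (hψT : ∀ w, ψ (T w) = 0) (hψe : ψ e = 1) (h0 : A u₀ + B u₀ u₀ + frc c = 0) (hr : 0 < r)
    (hυ0 : υ (c, 0) = u₀) (hυd : HasFDerivAt υ Dυ (c, 0))
    (hsol : ∀ q ∈ Metric.ball ((c, 0) : P × ℝ) r,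
      A (υ q) + B (υ q) (υ q) + frc q.1 - σ q • e = 0)
    (V : P × ℝ) (hV : ψ (frc V.1) = 0) :
    Tendsto (fun s : ℝ => s⁻¹ ^ 2 * σ ((c, 0) + s • V)) (𝓝[≠] 0)
      (𝓝 (ψ (B (Dυ V) (Dυ V)))) := by
  -- the quadratic form `w ↦ ψ (B w w)`: homogeneity and continuity
  have hQsmul : ∀ (t : ℝ) (w : X), ψ (B (t • w) (t • w)) = t ^ 2 * ψ (B w w) := by
    intro t w
    rw [B.map_smul₂, (B w).map_smul, smul_smul, ψ.map_smul, smul_eq_mul, sq]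
  have hQc : Continuous fun w : X => ψ (B w w) :=
    ψ.continuous.comp (B.continuous.clm_apply continuous_id)
  -- the exact reduced identity on the ball: `σ q = ψ (B z z) + ψ (frc (q.1 - c))`, `z = υ q - u₀`
  have hexp : ∀ z : X, A (u₀ + z) + B (u₀ + z) (u₀ + z) = (A u₀ + B u₀ u₀) + T z + B z z := by
    intro z
    simp only [hT, map_add, add_apply]
    abel
  have hred : ∀ q ∈ Metric.ball ((c, 0) : P × ℝ) r,
      σ q = ψ (B (υ q - u₀) (υ q - u₀)) + ψ (frc (q.1 - c)) := by
    intro q hq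
    have key := hexp (υ q - u₀)
    rw [add_sub_cancel] at key
    have h1 : T (υ q - u₀) + B (υ q - u₀) (υ q - u₀) + frc (q.1 - c) - σ q • e =
        (A (υ q) + B (υ q) (υ q) + frc q.1 - σ q • e) - (A u₀ + B u₀ u₀ + frc c) := by
      rw [key, frc.map_sub]
      abel
    rw [hsol q hq, h0, sub_zero] at h1
    have h2 : ψ (T (υ q - u₀) + B (υ q - u₀) (υ q - u₀) + frc (q.1 - c) - σ q • e) = 0 := by
      rw [h1, map_zero]
    rw [ψ.map_sub, ψ.map_add, ψ.map_add, hψT, ψ.map_smul, hψe, smul_eq_mul, mul_one,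
      zero_add] at h2
    linarith
  -- the blow-up `s⁻¹ • (υ ((c, 0) + s • V) - u₀) → Dυ V` (chain rule along the ray)
  have hsl : Tendsto (fun s : ℝ => s⁻¹ • (υ ((c, 0) + s • V) - u₀)) (𝓝[≠] 0) (𝓝 (Dυ V)) := by
    have hl : HasDerivAt (fun t : ℝ => ((c, 0) : P × ℝ) + t • V) V 0 := by
      simpa using ((hasDerivAt_id (0 : ℝ)).smul_const V).const_add ((c, 0) : P × ℝ)
    have hf' : HasFDerivAt υ Dυ (((c, 0) : P × ℝ) + (0 : ℝ) • V) := by simpa using hυd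
    simpa [hυ0] using (hf'.comp_hasDerivAt (0 : ℝ) hl).tendsto_slope_zero
  -- the ray stays in the ball of the family for small `s`
  have hpath : Tendsto (fun s : ℝ => ((c, 0) : P × ℝ) + s • V) (𝓝 0) (𝓝 (c, 0)) :=
    (by fun_prop : Continuous fun s : ℝ => ((c, 0) : P × ℝ) + s • V).tendsto' 0 (c, 0) (by simp)
  have hmem : ∀ᶠ s in 𝓝[≠] (0 : ℝ),
      ((c, 0) : P × ℝ) + s • V ∈ Metric.ball ((c, 0) : P × ℝ) r :=
    (hpath.eventually_mem (Metric.isOpen_ball.mem_nhds (Metric.mem_ball_self hr))).filter_mono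
      nhdsWithin_le_nhds
  -- on that event `s⁻² σ ((c, 0) + s • V) = ψ (B (s⁻¹ • z) (s⁻¹ • z))`, `z = υ (⋯) - u₀`
  refine ((hQc.tendsto _).comp hsl).congr' ?_
  filter_upwards [hmem] with s hs
  show ψ (B (s⁻¹ • (υ ((c, 0) + s • V) - u₀)) (s⁻¹ • (υ ((c, 0) + s • V) - u₀))) =
    s⁻¹ ^ 2 * σ ((c, 0) + s • V)
  have h1 : (((c, 0) : P × ℝ) + s • V).1 - c = s • V.1 := by simp
  rw [hQsmul, hred _ hs, h1, frc.map_smul, ψ.map_smul, hV, smul_zero, add_zero]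

/-! ## Robust crossing from an indefinite second-order form -/

/-- **Robust crossing from an indefinite second-order form — the invisible saddle**
(Kielhöfer 2012 §I.16; Chow–Hale 1982 Ch. 7; Golubitsky–Schaeffer 1985 Ch. II).  In the setting
of `robustCrossing_of_fold` (quadratic map `N u = A u + B u u`, linearisation `T` at the zero
`u₀` of `N + frc c`, cokernel functional `ψ` with `ψ ∘ T = 0`, `ψ e = 1`, Lyapunov–Schmidt
family `(σ, υ)` on the ball of radius `r` around `(c, 0)` with `υ (c, 0) = u₀` and `υ`
differentiable at `(c, 0)` with derivative `Dυ`), let the parameter direction `d` be INVISIBLE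
at first order, `ψ (frc d) = 0`, and let the second-order form
`x ↦ ψ (B (Dυ (d, x)) (Dυ (d, x)))` be INDEFINITE on the fibre `{d} × ℝ`: positive at `xp`,
negative at `xm`.  Then the reduced function changes sign in the kernel coordinate at parameters
`c + s d` arbitrarily close to `c`: for every `η > 0` there are `s, x₁, x₂` with
`dist (c + s d) c < η`, `|x₁|, |x₂| < η`, both `(c + s d, x₁)` and `(c + s d, x₂)` in the ball,
and `σ (c + s d, x₁) < 0 < σ (c + s d, x₂)` (namely `x₁ = s xm`, `x₂ = s xp` for a small
`s ≠ 0`, by the second-order blow-up `tendsto_sigma_div_sq` along the rays through `(d, xm)` and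
`(d, xp)`). [folklore] -/
theorem robustCrossing_of_indefinite (A : X →L[ℝ] Y) (B : X →L[ℝ] X →L[ℝ] Y) (T : X →L[ℝ] Y)
    (frc : P →L[ℝ] Y) (u₀ : X) (c : P) (e : Y) (ψ : Y →L[ℝ] ℝ) (σ : P × ℝ → ℝ)
    (υ : P × ℝ → X) (Dυ : P × ℝ →L[ℝ] X) (r : ℝ) (hT : ∀ w, T w = A w + B u₀ w + B w u₀)
    (hψT : ∀ w, ψ (T w) = 0) (hψe : ψ e = 1) (h0 : A u₀ + B u₀ u₀ + frc c = 0) (hr : 0 < r)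
    (hυ0 : υ (c, 0) = u₀) (hυd : HasFDerivAt υ Dυ (c, 0))
    (hsol : ∀ q ∈ Metric.ball ((c, 0) : P × ℝ) r,
      A (υ q) + B (υ q) (υ q) + frc q.1 - σ q • e = 0)
    (d : P) (hd : ψ (frc d) = 0) (xp xm : ℝ) (hpos : 0 < ψ (B (Dυ (d, xp)) (Dυ (d, xp))))
    (hneg : ψ (B (Dυ (d, xm)) (Dυ (d, xm))) < 0) :
    ∀ η : ℝ, 0 < η → ∃ (s x₁ x₂ : ℝ), dist (c + s • d) c < η ∧ |x₁| < η ∧ |x₂| < η ∧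
      ((c + s • d, x₁) : P × ℝ) ∈ Metric.ball ((c, 0) : P × ℝ) r ∧
      ((c + s • d, x₂) : P × ℝ) ∈ Metric.ball ((c, 0) : P × ℝ) r ∧
      σ (c + s • d, x₁) < 0 ∧ 0 < σ (c + s • d, x₂) := by
  intro η hη
  -- the rays through `(d, x)`: `(c, 0) + s • (d, x) = (c + s • d, s * x)`
  have hray : ∀ s x : ℝ, ((c, 0) : P × ℝ) + s • ((d, x) : P × ℝ) = (c + s • d, s * x) := by
    intro s x
    rw [Prod.smul_mk, Prod.mk_add_mk, zero_add, smul_eq_mul]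
  -- second-order blow-up along the rays (`tendsto_sigma_div_sq`; `d` is invisible)
  have hlim : ∀ x : ℝ, Tendsto (fun s : ℝ => s⁻¹ ^ 2 * σ (c + s • d, s * x)) (𝓝[≠] 0)
      (𝓝 (ψ (B (Dυ (d, x)) (Dυ (d, x))))) := fun x => by
    simpa only [hray] using tendsto_sigma_div_sq A B T frc u₀ c e ψ σ υ Dυ r hT hψT hψe h0 hr
      hυ0 hυd hsol (d, x) hd
  have hEp : ∀ᶠ s in 𝓝[≠] (0 : ℝ), 0 < s⁻¹ ^ 2 * σ (c + s • d, s * xp) :=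
    (hlim xp).eventually_const_lt hpos
  have hEm : ∀ᶠ s in 𝓝[≠] (0 : ℝ), s⁻¹ ^ 2 * σ (c + s • d, s * xm) < 0 :=
    (hlim xm).eventually_lt_const hneg
  -- ball membership and smallness along the rays, for small `s`
  have hpath : ∀ x : ℝ,
      Tendsto (fun s : ℝ => ((c + s • d, s * x) : P × ℝ)) (𝓝 0) (𝓝 (c, 0)) := fun x =>
    (by fun_prop : Continuous fun s : ℝ => ((c + s • d, s * x) : P × ℝ)).tendsto' 0 (c, 0)
      (by simp)
  have hmem : ∀ x : ℝ, ∀ᶠ s in 𝓝 (0 : ℝ),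
      ((c + s • d, s * x) : P × ℝ) ∈ Metric.ball ((c, 0) : P × ℝ) r := fun x =>
    (hpath x).eventually_mem (Metric.isOpen_ball.mem_nhds (Metric.mem_ball_self hr))
  have hsd : ∀ᶠ s in 𝓝 (0 : ℝ), ‖s • d‖ < η :=
    (((continuous_id.smul continuous_const).norm).tendsto' (0 : ℝ) 0 (by simp)).eventually_lt_const
      hη
  have hsx : ∀ x : ℝ, ∀ᶠ s in 𝓝 (0 : ℝ), |s * x| < η := fun x =>
    (((continuous_id.mul continuous_const).abs).tendsto' (0 : ℝ) 0 (by simp)).eventually_lt_const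
      hη
  -- one `s ≠ 0` in all these events (`𝓝[≠] 0` is nontrivial on `ℝ`)
  obtain ⟨s, hs0, hsp, hsm, hmp, hmm, hsd', hsxp, hsxm⟩ : ∃ s : ℝ, s ≠ 0 ∧
      0 < s⁻¹ ^ 2 * σ (c + s • d, s * xp) ∧ s⁻¹ ^ 2 * σ (c + s • d, s * xm) < 0 ∧
      ((c + s • d, s * xp) : P × ℝ) ∈ Metric.ball ((c, 0) : P × ℝ) r ∧
      ((c + s • d, s * xm) : P × ℝ) ∈ Metric.ball ((c, 0) : P × ℝ) r ∧
      ‖s • d‖ < η ∧ |s * xp| < η ∧ |s * xm| < η := by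
    refine Filter.Eventually.exists (f := 𝓝[≠] (0 : ℝ)) ?_
    filter_upwards [(self_mem_nhdsWithin : ({0}ᶜ : Set ℝ) ∈ 𝓝[≠] (0 : ℝ)), hEp, hEm,
      (hmem xp).filter_mono nhdsWithin_le_nhds, (hmem xm).filter_mono nhdsWithin_le_nhds,
      hsd.filter_mono nhdsWithin_le_nhds, (hsx xp).filter_mono nhdsWithin_le_nhds,
      (hsx xm).filter_mono nhdsWithin_le_nhds] with s h0 h₁ h₂ h₃ h₄ h₅ h₆ h₇
    exact ⟨Set.mem_compl_singleton_iff.1 h0, h₁, h₂, h₃, h₄, h₅, h₆, h₇⟩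
  -- undo the blow-up: `σ = s² · (s⁻² σ)` has the sign of `s⁻² σ`
  have hdist : dist (c + s • d) c = ‖s • d‖ := by rw [dist_eq_norm, add_sub_cancel_left]
  have hs2 : 0 < s ^ 2 := by positivity
  have hback : ∀ x : ℝ, σ (c + s • d, s * x) = s ^ 2 * (s⁻¹ ^ 2 * σ (c + s • d, s * x)) :=
    fun x => by rw [← mul_assoc, ← mul_pow, mul_inv_cancel₀ hs0, one_pow, one_mul]
  refine ⟨s, s * xm, s * xp, by rwa [hdist], hsxm, hsxp, hmm, hmp, ?_, ?_⟩
  · rw [hback]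
    exact mul_neg_of_pos_of_neg hs2 hsm
  · rw [hback]
    exact mul_pos hs2 hsp

/-- **Robust crossing from a positive discriminant** (Kielhöfer 2012 §I.16; Chow–Hale 1982
Ch. 7; Golubitsky–Schaeffer 1985 Ch. II).  Same setting as `robustCrossing_of_indefinite`, with
the indefiniteness of the second-order form on the fibre `{d} × ℝ` read off from its
coefficients: by linearity `Dυ (d, x) = w + x • g₁` with `g₁ = Dυ (0, 1)` (kernel direction) and
`w = Dυ (d, 0)`, so `ψ (B (Dυ (d, x)) (Dυ (d, x))) = a x² + bm x + e₂` with `a = ψ (B g₁ g₁)`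
(the fold coefficient), `bm = ψ (B g₁ w) + ψ (B w g₁)` (the mixed coefficient) and
`e₂ = ψ (B w w)`.  If the discriminant is positive, `discrim a bm e₂ = bm² − 4 a e₂ > 0` (two
transversal branches of the quadratic part: `a ≠ 0` with real distinct roots, or `a = 0 ≠ bm`),
the form takes both signs and the reduced function `σ` changes sign in the kernel coordinate at
parameters `c + s d` arbitrarily close to `c`, inside the ball of the family. [folklore] -/
theorem robustCrossing_of_discriminant_pos (A : X →L[ℝ] Y) (B : X →L[ℝ] X →L[ℝ] Y)
    (T : X →L[ℝ] Y) (frc : P →L[ℝ] Y) (u₀ : X) (c : P) (e : Y) (ψ : Y →L[ℝ] ℝ) (σ : P × ℝ → ℝ)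
    (υ : P × ℝ → X) (Dυ : P × ℝ →L[ℝ] X) (r : ℝ) (hT : ∀ w, T w = A w + B u₀ w + B w u₀)
    (hψT : ∀ w, ψ (T w) = 0) (hψe : ψ e = 1) (h0 : A u₀ + B u₀ u₀ + frc c = 0) (hr : 0 < r)
    (hυ0 : υ (c, 0) = u₀) (hυd : HasFDerivAt υ Dυ (c, 0))
    (hsol : ∀ q ∈ Metric.ball ((c, 0) : P × ℝ) r,
      A (υ q) + B (υ q) (υ q) + frc q.1 - σ q • e = 0)
    (d : P) (hd : ψ (frc d) = 0)
    (hdisc : 0 < discrim (ψ (B (Dυ (0, 1)) (Dυ (0, 1))))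
      (ψ (B (Dυ (0, 1)) (Dυ (d, 0))) + ψ (B (Dυ (d, 0)) (Dυ (0, 1))))
      (ψ (B (Dυ (d, 0)) (Dυ (d, 0))))) :
    ∀ η : ℝ, 0 < η → ∃ (s x₁ x₂ : ℝ), dist (c + s • d) c < η ∧ |x₁| < η ∧ |x₂| < η ∧
      ((c + s • d, x₁) : P × ℝ) ∈ Metric.ball ((c, 0) : P × ℝ) r ∧
      ((c + s • d, x₂) : P × ℝ) ∈ Metric.ball ((c, 0) : P × ℝ) r ∧
      σ (c + s • d, x₁) < 0 ∧ 0 < σ (c + s • d, x₂) := by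
  -- `Dυ (d, x) = w + x • g₁` and the binary quadratic form of the fibre
  have hDx : ∀ x : ℝ, Dυ (d, x) = Dυ (d, 0) + x • Dυ (0, 1) := fun x => by
    have h : ((d, x) : P × ℝ) = (d, 0) + x • ((0 : P), (1 : ℝ)) := by simp
    rw [h, map_add, map_smul]
  have hquad : ∀ x : ℝ, ψ (B (Dυ (d, x)) (Dυ (d, x))) =
      ψ (B (Dυ (0, 1)) (Dυ (0, 1))) * (x * x) +
        (ψ (B (Dυ (0, 1)) (Dυ (d, 0))) + ψ (B (Dυ (d, 0)) (Dυ (0, 1)))) * x +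
        ψ (B (Dυ (d, 0)) (Dυ (d, 0))) := fun x => by
    rw [hDx x]
    simp only [map_add, map_smul, add_apply, smul_apply, smul_eq_mul]
    ring
  -- a real binary quadratic with positive discriminant takes both signs
  obtain ⟨xm, hxm⟩ : ∃ x : ℝ, ψ (B (Dυ (d, x)) (Dυ (d, x))) < 0 := by
    by_contra h
    push Not at h
    exact (not_le.2 hdisc) (discrim_le_zero fun x => by rw [← hquad]; exact h x)
  obtain ⟨xp, hxp⟩ : ∃ x : ℝ, 0 < ψ (B (Dυ (d, x)) (Dυ (d, x))) := by
    by_contra h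
    push Not at h
    exact (not_le.2 hdisc) (discrim_le_zero_of_nonpos fun x => by rw [← hquad]; exact h x)
  exact robustCrossing_of_indefinite A B T frc u₀ c e ψ σ υ Dυ r hT hψT hψe h0 hr hυ0 hυd hsol d
    hd xp xm hxp hxm

end SecondOrderIndefinite

end Literature.Analysis.Calculus

end
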